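import Mathlib
import HarnessLib
import HarnessLib.Audit
import Summits.AtomisticToContinuum.Statement

/-!
Route: BallwiseGibbsReferences

CLOSED (retired) 2026-08-15T13:41:07Z by operator:999:1257524 — reason: not-a-thesis: assembly does not conclude the sub-problem Statement — note: D-0027 §2.1 audit (human 2026-08-15: routes that do not decide the summit are removed): the assembly concludes `Literature.MathematicalPhysics.KineticTheory.HydrodynamicLimit`, not the sub-problem statement; a NEW conforming route may be opened from the same idea (generated `closes : … → _root_.Hydr. The file is kept as the record of this route; refuted decls are indexed as negative knowledge (`ledger negatives`).

# Route BallwiseGibbsReferences — ball-wise invariant Gibbs references make local flux-Gibbsianity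
(anomalous current ≤ C·entropy) suffice for Euler

It suffices to show X = LocalFluxGibbsianity ∧ EnergyCurrentTails ∧ FastCollisionThroughput (card
local-flux-gibbsianity-ballwise).
LocalFluxGibbsianity (LFG, typed, the ergodic input): for the HOMOGENEOUS (flow-invariant) canonical
hard-sphere Gibbs laws on 𝕋³ at
every small reduced density σ' and Maxwellian (u, θ) in compact boxes there is a tilt size β₀ > 0
such that the window pressure
(M+1)⁻¹ log E exp(X) of the block-recentred, velocity-truncated, COLLISION-RESOLVED current
functional X — kinetic transport plus the
momentum/energy transfers of the collisions of the a.e. trajectory (finsum over collisionTimes,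
pre-collisional left limit, transfer located
on the contact segment), tested against ARBITRARY smooth vector/tensor fields of sup-norm ≤ β₀,
minus the hard-sphere Euler flux of the
block-averaged fields, rate-averaged over a window of L·(M+1)^(-1/3) — has limsup_M ≤ δ for every δ
> 0 once K (velocity cut), then L
(window), then k (block) are large. By convex duality this is LOCAL flux-Gibbsianity: locally
invariant states carry anomalous current at
most β₀⁻¹ × their specific relative entropy — not "stationary ⇒ Gibbs" and not "anomalous current =
0 for all tilts". The two tails items
(cubic kinetic UI = KineticWindows' EnergyCurrentTails, and vanishing FAST-collision throughput,
both pre-shock under the true law) are the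
truncation errors. BallwiseSufficiency (typed implication) turns X into the shared target
RelEntropyVanishing (stmt-0766) by Yau's Gronwall
with BALL-WISE invariant references at the local Euler parameters (entropy mismatch O(r²) + r√h ⇒
H/N = O(r²) for every r), and
EntropyToFields (stmt-0769) gives the conjunct.
Lean: `LocalFluxGibbsianity ∧ EnergyCurrentTails ∧ FastCollisionThroughput`

## Assembly
Pure logic (sorry-free in Sketch.lean, `assembly_holds`): BallwiseSufficiency applied to ⟨LFG,
tails, throughput⟩ gives RelEntropyVanishing,
and EntropyToFields gives the conjunct
`Literature.MathematicalPhysics.KineticTheory.HydrodynamicLimit` (= `HydrodynamicLimit` of the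
sub-problem Statement by `rfl`).

Rationale: WHY THIS LINE. Yau's relative entropy method (Yau1991; OllaVaradhanYau1993 Thm 2.1 with weak noise;
KipnisLandim1999 Ch. 6) needs its ergodic input in ONE
place, the one-block replacement of fast currents; OVY feed it with a classification of all
finite-entropy stationary states (the Boltzmann
hypothesis, stmt-0779 in route RelEntropyErgodic), Bernardin2014 §1.1 notes weaker conditions might
do. The card's move: keep the torus
Gronwall but, for the one-block term only, cover 𝕋³ by macroscopic balls of radius r and apply the
entropy inequality ball by ball against
the marginal of the INVARIANT homogeneous Gibbs state at the ball's local Euler parameters; the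
entropy mismatch is second order
(N_B(Cr² + Cr√h_B)), and under an invariant reference time averaging is free (a large-deviation
pressure of the equilibrium dynamics,
Kifer1990-type duality over invariant states) — so only tilts of size ≤ β₀ are ever probed and the
needed input shrinks to a LINEAR
anomalous-current/entropy bound around each Gibbs state (first order = zero excess Drude weight of
the projected currents, Spohn1991 §7.1,
Doyon2022; second order = bounded current response along invariant directions). Imported areas:
large deviations / convex duality for
dynamical pressures, linear response. Versus the routes on file: RelEntropyErgodic asks the full
classification (0779); LdDrudeFluxGibbsianity
(opened today) types a GLOBAL-torus LD decay of bounded one-body observables orthogonal to the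
collision invariants with a restart-type
sufficiency; KineticWindows restarts from the non-invariant local Gibbs law over finite windows;
this route instead fixes the reference
(invariant, ball-wise), which forces — and this is its technical content — a collision-resolved
current tested against non-gradient tensor
fields (gradient-tested flow differences cannot be localised to balls with O(1) tilts, nor
velocity-truncated without destroying the pair
cancellation that carries the factor ε), block recentring at the hard-sphere equation of state (so
that smooth local-Gibbs tilts cost
entropy but carry no recentred current), and typed tails in the fast-collision-throughput currency
of card apriori-tails-and-rattlers.

RANKED CRUXES. #0 RelEntropyVanishing (target) — Yau's relative-entropy form of the hydrodynamic
limit (stmt-AtomisticToContinuum-0766 verbatim, shared with RelEntropyErgodic / ChaoticMixing /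
VanishingNoise / KineticWindows / LdDrudeFluxGibbsianity): specific relative entropy of the true
time-t law w.r.t. an exponentially concentrating local Gibbs law at the Euler parameters vanishes,
pre-shock, at small reduced density. (why it might fail: entropy production ≥ cN before the first
shock for some smooth data (e.g. implosion-type focusing, card implosion-loophole) refutes every
Yau-type route at once; nothing of the kind is known.) [Yau1991, OllaVaradhanYau1993]
#2 LocalFluxGibbsianity (crux) — LOCAL FLUX-GIBBSIANITY IN PRESSURE FORM (card crux 1, torus
version). ∃ σ₀ > 0 such that for every parameter box 0 < σlo ≤ σ' ≤ σhi < σ₀, 0 < θlo ≤ θ ≤ θhi, |u|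
≤ U there is β₀ > 0 with: for every diameter sequence ε_M > 0 with (M+1)ε_M³ → σ'³, every family of
hard-sphere flows Φ_M of M+1 spheres on 𝕋³, all smooth test fields A₀, A₄ : 𝕋³ → ℝ³ and A : Fin 3 →
𝕋³ → ℝ³ of sup-norm ≤ β₀, and every δ > 0: ∃ K₀ ∀ K ≥ K₀ ∃ L₀ ∀ L ≥ L₀ ∃ k₀ ∀ k ≥ k₀, limsup_M
(M+1)⁻¹ log ∫ exp(X) dG_M ≤ δ, where G_M = particleLaw(canonicalDensity, constant activity 1,
Maxwellian drift u, temperature θ) is the homogeneous flow-invariant Gibbs law and X = τ⁻¹ [ ∫_0^τ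
kin ds + Σ_(collision times s ∈ (0,τ]) coll(γ(s⁻), γ(s)) − ∫_0^τ flux ds ] along γ(s) = Φ_M.flow s
z, with τ = L(M+1)^(-1/3) (micro window), block radius ℓ = k(M+1)^(-1/3): kin = Σ_i 1(|v_i| ≤
K)[⟨A₀(x_i),v_i⟩ + Σ_k ⟨A_k(x_i),v_i⟩ v_i,k + ⟨A₄(x_i),v_i⟩|v_i|²/2] (truncated kinetic
mass/momentum/energy currents); coll = Σ_i 1(|v_i⁻|,|v_i⁺| ≤ K) (ε/2)∫_0^1 [Σ_k ⟨A_k(x_i − rεω_i),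
ω_i⟩ Δ_i,k + ⟨A₄(x_i − rεω_i), ω_i⟩ (|v_i⁺|² − |v_i⁻|²)/2] dr with Δ_i = v_i⁺ − v_i⁻, ω_i =
Δ_i/|Δ_i| (each particle's half of the collisional momentum/energy transfer, located on the contact
segment; vanishes for non-colliding i); flux = (M+1)∫_𝕋³ [⟨A₀,m̄⟩ + Σ_k(⟨A_k,m̄⟩ū_k + p̄ (A_k)_k) +
⟨A₄,ū⟩(ē + p̄)] dx, the hard-sphere Euler flux of the truncated block fields (ρ̄, m̄, ē) =
cone-kernel averages at radius ℓ of (1, v, |v|²/2) over particles with |v| ≤ K, ū = m̄/ρ̄, θ̄ =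
(2/3)(ē/ρ̄ − |ū|²/2), p̄ = ρ̄ θ̄ Z(min(ρ̄,2)σ'³), Z = hsCompressibility. Dual reading (informal crux
InvariantStateLFG, filed after open): locally invariant states of the infinite dynamics near g_U
carry block-recentred anomalous current ≤ β₀⁻¹ × specific relative entropy. [difficulty:
open-problem] (why it might fail: a SOFT anomalous mode — invariant states ν_n → g_U with recentred
current e ~ s^γ, γ < 1 (excess Drude weight of stress/heat flux, or unbounded 2nd-order response) —
gives limsup > 0 for all β₀, as for the ideal gas and d = 1 rods; or anomalous window LD of the
truncated virial.) [OllaVaradhanYau1993, Spohn1991, Bernardin2014, Kifer1990, Doyon2022,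
BuragoFerlegerKononenko1998]
#3 EnergyCurrentTails (crux) — uniform integrability, in the mean under the true law and before the
first shock, of the cubic velocity moments (stmt-AtomisticToContinuum-3655 verbatim, filed by route
KineticWindows; the corrected form of 0781): ∀ t < T ∀ ε > 0 ∃ M ∃ N₀ ∀ N ≥ N₀ ∀ s ≤ t, E[(N+1)⁻¹
Σ_i |v_i(s)|³ 1(|v_i(s)| > M)] ≤ ε. Controls the kinetic truncation error and the locality tails of
BallwiseSufficiency. [difficulty: open-problem] (why it might fail: the deterministic flow could
focus energy ≍ N^(2/3) on O(1) particles with non-vanishing probability — invisible to entropy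
(sub-exponential LD cost of cubic tails) and to domination by Gibbs; no Povzner/maximum principle
for the N-body hard-sphere flow is known.) [NachtergaeleYau2003, OllaVaradhanYau1993, Spohn1991]
#4 FastCollisionThroughput (crux) — VANISHING FAST-COLLISION THROUGHPUT under the true law,
pre-shock (the collisional truncation error of LFG's functional, in the currency of card
apriori-tails-and-rattlers): for continuous profiles ∃ σ₀ ∀ σ < σ₀ ∀ classical hs-Euler solutions on
[0,T) ∀ flow families, if the local Gibbs fields converge at t = 0 then ∀ t < T ∀ η > 0 ∃ K ∃ N₀ ∀ N
≥ N₀: (N+1)^(-4/3) E[ Σ_i Σ_(collision times s ≤ t) 1(max(|v_i(s⁻)|,|v_i(s)|) > K) (1 +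
|v_i(s)+v_i(s⁻)|/2) |v_i(s) − v_i(s⁻)| ] ≤ η (normalisation: (N+1)^(4/3) = order of the total number
of collisions on [0,t]; the summand vanishes unless i collides at s). [difficulty: L] (why it might
fail: needs collision-RATE control of fast particles under the non-equilibrium law (contact pair
densities of f_t around fast spheres); channelled fast spheres or transient dense clusters could
carry O(1) throughput at polynomially small probability, which entropy bounds cannot see.)
[BuragoFerlegerKononenko1998, GST2013, Alexander1975, NachtergaeleYau2003]
#5 BallwiseSufficiency (crux) — THE BALL-WISE SUFFICIENCY THEOREM (card crux 2 made an implication,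
X → target): LocalFluxGibbsianity ∧ EnergyCurrentTails ∧ FastCollisionThroughput →
RelEntropyVanishing. Proof plan: Yau's Gronwall for H(f_t | ψ_t) on the torus with ψ_t the local
Gibbs law driven by the classical solution; quadratic remainder by static LD; for the one-block term
tile [0,t] by micro windows L(N+1)^(-1/3), cover 𝕋³ by balls of radius r with a partition of unity
χ_B, test the collision-resolved recentred current against χ_B∇λ_t (non-gradient, sup-norm ≤ β₀
after choosing the entropy-inequality parameter a = β₀/sup|∇λ_t|), apply the entropy inequality
ball-wise to the B⁺-marginal of f_t against the marginal of the homogeneous Gibbs law of an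
(M+1)-sphere torus system with M+1 ≈ ρ_B(N+1) and parameters (σρ_B^(1/3), u_B, θ_B) on an r-grid;
entropy mismatch ≤ N_B(h_B + Cr² + Cr√h_B) + o(N_B) (second order in r; cross term via the static
entropy inequality), Σ_B N_B h_B ≤ C_ov H + o(N) (superadditivity for near-product hard-core
references), microscopic locality of X_B over the window from deterministic light cones for
particles slower than K plus items 3–4, pressures from LFG, and d(H/N)/dt ≤ C₁H/N + C₂r² + C₃r√(H/N)
+ δ ⇒ limsup_N H(t)/N ≤ A(t)(r² + δ) for all r, δ. Static inputs (LocalGibbsConcentration 0767,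
HsEosLowDensity 0768, virial EOS identification 0782-type) are consumed as separately filed support
items / --supports lemmas. [deps: LocalFluxGibbsianity, EnergyCurrentTails, FastCollisionThroughput]
[difficulty: XL] (why it might fail: window locality under f_t with only cubic-UI tails, the o(N_B)
hard-core boundary/ensemble corrections for ball marginals, the parameter/time grids and the inverse
equation of state for a_t must all close at o(N); any of these may demand more than items 3–4
supply.) [Yau1991, OllaVaradhanYau1993, KipnisLandim1999, Spohn1991]
#9 EntropyToFields (support) — RelEntropyVanishing → HydrodynamicLimit by the entropy inequality
μ(A) ≤ (log 2 + H(μ|λ))/log(1 + 1/λ(A)) and lawAt = map (flow t) (stmt-AtomisticToContinuum-0769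
verbatim). [difficulty: provable-now] [KipnisLandim1999, Yau1991]

TWO-LAYER PLAN. Foreseen glued splits (none filed now): LocalFluxGibbsianity ⇐ InvariantStateLFG
(duality upper bound over locally invariant states, needs the
infinite-volume definitions requested by LdDrudeFluxGibbsianity / 0779) → LinearisedLFG (zero excess
Drude weight of the projected currents +
ℋ-valued invariant tangents of entropy-vanishing invariant states; first typed rung = route's own
FastObservableMeanErgodic-type L² statement
and the stationary-shear instance of card stationary-shear-rung) → SecondOrderResponse →
LocalFluxGibbsianity; BallwiseSufficiency ⇐
WindowLocality → BallMarginalMismatch → GronwallClosure (k ≤ 3, depth 1). The δ^(7/3) ACOUSTIC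
corollary of the card (small-amplitude data,
linearised hs-Euler, from the L² rung + a third-cumulant bound) is a special-case target to file
when LinearisedLFG is typed.

KILL CRITERIA. ¬LocalFluxGibbsianity closes the route outright (close --reason
refuted:LocalFluxGibbsianity): e.g. a family of translation-invariant,
flow-invariant, finite-entropy states of infinite 3-d hard spheres at small packing approaching a
Gibbs state with anisotropic stress or
heat flux ≫ their specific relative entropy (a soft anomalous mode; this also kills 0779, LdDrude's
KineticFluxLdDecay and ChaoticMixing's
premise), or an N-growing plateau of (M+1)⁻¹ log E_G exp(X) in L at fixed small β₀.
¬FastCollisionThroughput or ¬EnergyCurrentTails with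
LFG standing ⇒ pivot: restate BallwiseSufficiency with Gaussian-moment tails
(Literature.Barriers.AtomisticToContinuum.HighMomentumCutoff σ,
pre-shock) as hypothesis. ¬RelEntropyVanishing closes this and every Yau-family route.
RelEntropyVanishing proved elsewhere moots items 5 and 9
but not LFG as mathematics; KineticFluxLdDecay (LdDrude) proved does NOT moot LFG (different
functional: collisional part, tensor tests).

NOT DECOMPOSED YET. The invariant-state (dual) form of LFG and its linear/second-order rungs (wait
for the infinite-volume definitions); the locality lemma, the
ball-marginal mismatch estimate with hard-core boundary layers, the r-grid of reference parameters
and the time grid of test fields, the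
inverse equation of state for a_t (all layer-2 children of BallwiseSufficiency); Galilean/scaling
covariance reductions; the static inputs
0767/0768/0782 (filed in other routes, consumed here); the acoustic corollary. Constants β₀, K₀, L₀,
k₀ are existential on purpose.

CHEAPEST FALSIFIER. (i) Paper check, one page: run the functional X on the IDEAL GAS (ε-sequence
with σ' → 0 formally, no collisions): kin tested with a
traceless A gives limsup_M (M+1)⁻¹ log E exp(X) = c(θ)·∫|A|² + O(K-tails) > 0 for every L, k — LFG
must fail there and ONLY through the
missing collisions (free transport conserves v⊗v); any other failure mode means the functional is
mis-normalised. Done by hand while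
drafting: the block term is centred (∫ of a constant flux against the block fields' fluctuations is
o(M)), the kinetic tilt is a Gaussian
tilt of each velocity, positive pressure ∝ β₀² — as it must be. (ii) MD (kit, not run in this
one-shot seat): N = 10³–10⁵ hard spheres at
packing 0.05–0.2, finite-size scaling of (M+1)⁻¹ log E_G exp(X) for A = small constant shear tensor
versus L: a plateau growing with N
refutes LFG; published Green–Kubo data (stress autocorrelation integrable, t^(-3/2) tail,
doi:10.1063/1.1673845) predict decay ∝ 1/L.
(iii) Lookup: any printed non-Gibbs translation-invariant stationary state of finite specific
entropy for 3-d hard spheres with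
non-Eulerian fluxes (none in OllaVaradhanYau1993, Spohn1991, Bernardin2014).

NUMBERS. Scales (macro units, N+1 spheres of diameter σ(N+1)^(-1/3) on the unit torus): micro length
ι = (M+1)^(-1/3); window τ = Lι (L ≍ number of
mean free times × σ'²√θ); block radius kι (≈ 4k³ particles); balls of macroscopic radius r → 0 last;
velocity cut K; limits N → ∞, then
K, L, k → ∞ in the order ∀δ ∃K₀ ∀K ∃L₀ ∀L ∃k₀ ∀k, then r → 0. Expected sizes: Λ_L = O(β₀²/L) +
O(L^(-3/2)) (Green–Kubo + long-time tail)
given LFG; entropy mismatch per ball N_B(Cr² + Cr√h_B); Gronwall output limsup_N H(t)/N ≤ A(t) r².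
Compressibility cap at normalised block
density 2 (2σ'³ < η₀ of HsEosLowDensity). Items at open: 7 typed (target, 4 cruxes, 1 support,
assembly) + 1 informal crux filed after open.

DEFINITION REQUESTS. None new. The informal crux InvariantStateLFG (rank 6, filed after open) waits
for the three definitions already requested by route
LdDrudeFluxGibbsianity / item 0779 (InfiniteHardSphereDynamics, HardSphereSpecificRelEntropy,
CollisionalTransferAlongFlow); the typed
items of this route inline the collision-resolved transfer (finsum over
`Literature.Analysis.FluidPDE.collisionTimes` with `Function.leftLim`)
and would shorten once CollisionalTransferAlongFlow lands.

Novelty: Searches (2026-08-15, this seat; remote APIs rate-limited — OpenAlex/S2/arXiv 429, logged): `lit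
search --hybrid "relative entropy method
local Gibbs reference invariant measure ball localization hydrodynamic limit Hamiltonian"` (10 held
books: KipnisLandim1999 Ch. 6,
Spohn1991, SaintRaymond2009, DeMasiPresutti1991, Arkeryd–Lions–Markowich 1993 …; none localises the
reference measure); `lit search
--hybrid "Olla Varadhan Yau hydrodynamical limit Hamiltonian weak noise one block ergodic" --source
local` (6; same books); `lit search
--hybrid "Lagrange Jacobi identity virial hard spheres collisions cluster"` (5; CIP1994 p. 73
collision bounds); `lit galaxy search
"relative entropy method" --star pdf` (6 rows: arXiv:2401.17651 relative entropy for Euler–Poisson,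
Lu Xu hyperbolic fluctuations of a
weakly anharmonic chain — PDE/stochastic-chain uses, no localised reference), `lit galaxy search
"hydrodynamic limit of hard spheres"
--star all` (0), two longer galaxy phrases (0); the card's own audited searches (OVY pp. 3, 15–18;
Spohn1991 pp. 11, 40–46, 53; crossref
sweeps) and today's route files LdDrudeFluxGibbsianity / KineticWindows / FirstFailureBlowup (read
in full for overlap).
Nearest prior art found: OllaVaradhanYau1993 §3–4 (Thm 3.10: the classification is used only for
currents); Sinai's LD-conditional 1-d
Euler derivation reported in Spohn1991 (notes to §3.2); Bernardin2014 §1.1 ("weaker or different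
conditions could suffice"); Kifer1990
(LD upper bounds as sup over invar  [refs: 2401.17651, KipnisLandim1999, Spohn1991, SaintRaymond2009, CIP1994, OllaVaradhanYau1993, Bernardin2014, Kifer1990]

Barriers (technique_class: relative-entropy linear-response large-deviations): - technique_class: relative-entropy linear-response large-deviations
- Literature.Barriers.AtomisticToContinuum.BoltzmannHypothesisBarrier: weakened, not evaded: the
input is "locally invariant states carry anomalous current ≤ C × entropy" (LFG), strictly weaker
than "stationary ⇒ Gibbs mixture" (0779) and than flux-Gibbsianity for all tilts; the barrier's
formal kernel (ideal gas, arbitrary velocity law h: anomalous stress ~ |h−M| at entropy cost ~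
|h−M|²) is exactly a case where LFG is false, for the right reason (no collisions); the bet is that
near-equilibrium current rigidity of 3-d hard spheres is provable where classification is not.
- Literature.Barriers.AtomisticToContinuum.BoltzmannHypothesisBarrierNarrow: adopted as frame (the
method consumes a flux-level closure); LFG is a local, typed, finite-N form of that closure
including the collisional transfer.
- Literature.Barriers.AtomisticToContinuum.MacroErgodicityBarrier: applies in spirit (same missing
input); Bernardin's "weaker conditions" clause is instantiated; no sector condition or spectral gap
at Euler scale is asked.
- Literature.Barriers.AtomisticToContinuum.HighMomentumCutoffBarrier: it does not evade it; the bet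
is items 3–4 (cubic UI + fast-collision throughput, pre-shock, in the mean) — weaker than
Nachtergaele–Yau's Gaussian II.1 and exactly what the truncated functional needs; the exponential
moments in LFG are taken of TRUNCATED currents only (the untruncated cubic heat flux has infinite
pressure under

History (route lifecycle, newest last):
- 2026-08-15T12:39:58Z · rev 1: restated BallwiseSufficiency (stmt-AtomisticToContinuum-6456) — clear the stale BLOCKED flag of 6456 (set in the superseded route BallwiseFluxGibbsianity where RelEntropyVanishing was missing): restate in arrow form; all ref (planner-plancard-AtomisticToContinuum-Hydrody-86786698-0)
- 2026-08-15T12:41:01Z · rev 2: restated Assembly (stmt-AtomisticToContinuum-8237) — clear the stale BLOCKED flag of the assembly (BallwiseSufficiency now precedes it in the file): restate the chain in crux order (planner-plancard-AtomisticToContinuum-Hydrody-86786698-0)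
- 2026-08-15T13:41:07Z · CLOSED retired — not-a-thesis: assembly does not conclude the sub-problem Statement (operator:999:1257524)

sub-problem: HydrodynamicLimit · status: closed(retired) · opened planner-plancard-AtomisticToContinuum-Hydrody-86786698-0 2026-08-15T12:35:51Z · rev 2 · ledger route-AtomisticToContinuum-BallwiseGibbsReferences
GENERATED by the gate from the ledger (D-0016/17). Provers cite these decls: `theorem foo : Summit.AtomisticToContinuum.HydrodynamicLimit.Theses.BallwiseGibbsReferences.<Decl> := …` in Summits/AtomisticToContinuum/HydrodynamicLimit/Theorems/<Name>.lean.
-/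

namespace Summit.AtomisticToContinuum.HydrodynamicLimit.Theses.BallwiseGibbsReferences

open scoped BigOperators Topology Manifold Classical MeasureTheory ProbabilityTheory Matrix InnerProductSpace ComplexConjugate ContinuousMap
open Filter Set Function TopologicalSpace MeasureTheory

attribute [summit_statement] _root_.HydrodynamicLimit

/-- item stmt-AtomisticToContinuum-0766 · target · rank 0 · open · by planner
why it might fail: entropy production ≥ cN before the first shock for some smooth data (e.g. implosion-type focusing, card implosion-loophole) refutes every Yau-type route at once; nothing of the kind is known.
sources: Yau1991, OllaVaradhanYau1993
[target] X_RE: for all continuous profiles ∃ σ₀ ∀ σ<σ₀ ∀ classical hs-Euler solutions on [0,T) ∀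
flows: the initial local Gibbs laws are probability measures and, if their fields converge at t=0,
then ∀ t<T ∃ activity profile a_t such that the reference local Gibbs law (a_t, u_t, θ_t) is a
probability measure whose empirical density/momentum/energy fields concentrate exponentially (≤ C
e^{-(N+1)/C}) around (ρ,ρu,E)(t), and klDiv(lawAt Φ_N (localGibbs a₀u₀θ₀) t ‖ localGibbs a_t u_t
θ_t)/(N+1) → 0. Yau1991; OllaVaradhanYau1993 Thm 1.1 (with noise). -/
@[route_item "route-AtomisticToContinuum-BallwiseGibbsReferences"]
def RelEntropyVanishing : Prop :=
  ∀ (a₀ θ₀ : Literature.MathematicalPhysics.KineticTheory.T3 → ℝ) (u₀ : Literature.MathematicalPhysics.KineticTheory.T3 → Literature.MathematicalPhysics.KineticTheory.V3), Continuous a₀ → Continuous θ₀ → Continuous u₀ → (∀ x, 0 < a₀ x) → (∀ x, 0 < θ₀ x) → ∃ σ₀ : ℝ, 0 < σ₀ ∧ ∀ σ : ℝ, 0 < σ → σ < σ₀ → ∀ (T : ℝ) (ρ θ : ℝ → Literature.MathematicalPhysics.KineticTheory.T3 → ℝ) (u : ℝ → Literature.MathematicalPhysics.KineticTheory.T3 →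 Literature.MathematicalPhysics.KineticTheory.V3), Literature.MathematicalPhysics.KineticTheory.IsHardSphereEulerSolution σ T ρ u θ → ∀ Φ : (N : ℕ) → Literature.Analysis.FluidPDE.HardSphereFlow (Literature.Analysis.FluidPDE.Torus.geometry (Fin 3)) (Literature.MathematicalPhysics.KineticTheory.hsDiameter σ N) (N + 1), (∀ N, MeasureTheory.IsProbabilityMeasure (Literature.MathematicalPhysics.KineticTheory.localGibbsLaw σ a₀ u₀ θ₀ N (Φ N))) ∧ (Literature.MathematicalPhysics.KineticTheory.TendstoHydroFieldsAt (fun N => Literature.MathematicalPhysics.KineticTheory.localGibbsLaw σ a₀ u₀ θ₀ N (Φ N)) Φ ρ u θ 0 → ∀ t ∈ Set.Ico 0 T, ∃ a : Literature.MathematicalPhysics.KineticTheory.T3 → ℝ, (∀ N, MeasureTheory.IsProbabilityMeasure (Literature.MathematicalPhysics.KineticTheory.localGibbsLaw σ a (u t) (θ t) N (Φ N))) ∧ (∀ χ : Literature.MathematicalPhysics.KineticTheory.T3 → ℝ, Continuous χ → ∀ δ : ℝ, 0 < δ → ∃ C : ℝ, 0 < C ∧ ∀ N : ℕ, Literature.MathematicalPhysics.KineticTheory.localGibbsLaw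 σ a (u t) (θ t) N (Φ N) {z | δ < |Literature.MathematicalPhysics.KineticTheory.empiricalDensityField z χ - ∫ x, χ x * ρ t x|} ≤ ENNReal.ofReal (C * Real.exp (-(C⁻¹ * (N + 1)))) ∧ Literature.MathematicalPhysics.KineticTheory.localGibbsLaw σ a (u t) (θ t) N (Φ N) {z | δ < ‖Literature.MathematicalPhysics.KineticTheory.empiricalMomentumField z χ - ∫ x, (χ x * ρ t x) • u t x‖} ≤ ENNReal.ofReal (C * Real.exp (-(C⁻¹ * (N + 1)))) ∧ Literature.MathematicalPhysics.KineticTheory.localGibbsLaw σ a (u t) (θ t) N (Φ N) {z | δ < |Literature.MathematicalPhysics.KineticTheory.empiricalEnergyField z χ - ∫ x, χ x * Literature.MathematicalPhysics.KineticTheory.totalEnergyDensity (ρ t x) (u t x) (θ t x)|} ≤ ENNReal.ofReal (C * Real.exp (-(C⁻¹ * (N + 1))))) ∧ Filter.Tendsto (fun N : ℕ => InformationTheory.klDiv ((Φ N).lawAt (Literature.MathematicalPhysics.KineticTheory.localGibbsLaw σ a₀ u₀ θ₀ N (Φ N)) t) (Literature.MathematicalPhysics.KineticTheory.localGibbsLaw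 σ a (u t) (θ t) N (Φ N)) / ((N : ENNReal) + 1)) Filter.atTop (nhds 0))

/-- item stmt-AtomisticToContinuum-6454 · crux · rank 2 · closed · moot by None · by planner
why it might fail: a SOFT anomalous mode — invariant states ν_n → g_U with recentred current e ~ s^γ, γ < 1 (excess Drude weight of stress/heat flux, or unbounded 2nd-order response) — gives limsup > 0 for all β₀, as for the ideal gas and d = 1 rods; or anomalous window LD of the truncated virial.
sources: OllaVaradhanYau1993, Spohn1991, Bernardin2014, Kifer1990, Doyon2022, BuragoFerlegerKononenko1998
[crux] LOCAL FLUX-GIBBSIANITY IN PRESSURE FORM (card crux 1, torus version). ∃ σ₀ > 0 such that for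
every parameter box 0 < σlo ≤ σ' ≤ σhi < σ₀, 0 < θlo ≤ θ ≤ θhi, |u| ≤ U there is β₀ > 0 with: for
every diameter sequence ε_M > 0 with (M+1)ε_M³ → σ'³, every family of hard-sphere flows Φ_M of M+1
spheres on 𝕋³, all smooth test fields A₀, A₄ : 𝕋³ → ℝ³ and A : Fin 3 → 𝕋³ → ℝ³ of sup-norm ≤ β₀, and
every δ > 0: ∃ K₀ ∀ K ≥ K₀ ∃ L₀ ∀ L ≥ L₀ ∃ k₀ ∀ k ≥ k₀, limsup_M (M+1)⁻¹ log ∫ exp(X) dG_M ≤ δ,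
where G_M = particleLaw(canonicalDensity, constant activity 1, Maxwellian drift u, temperature θ) is
the homogeneous flow-invariant Gibbs law and X = τ⁻¹ [ ∫_0^τ kin ds + Σ_(collision times s ∈ (0,τ])
coll(γ(s⁻), γ(s)) − ∫_0^τ flux ds ] along γ(s) = Φ_M.flow s z, with τ = L(M+1)^(-1/3) (micro
window), block radius ℓ = k(M+1)^(-1/3): kin = Σ_i 1(|v_i| ≤ K)[⟨A₀(x_i),v_i⟩ + Σ_k ⟨A_k(x_i),v_i⟩
v_i,k + ⟨A₄(x_i),v_i⟩|v_i|²/2] (truncated kinetic mass/momentum/energy currents); coll = Σ_i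
1(|v_i⁻|,|v_i⁺| ≤ K) (ε/2)∫_0^1 [Σ_k ⟨A_k(x_i − rεω_i), ω_i⟩ Δ_i,k + ⟨A₄(x_i − rεω_i), ω_i⟩ (|v_i⁺|²
− |v_i⁻|²)/2] dr with Δ_i = v_i⁺ − v_i⁻, ω_i = Δ_i/|Δ_i| (each particle's half of the collisional
momentum/energy trans -/
@[route_item "route-AtomisticToContinuum-BallwiseGibbsReferences"]
def LocalFluxGibbsianity : Prop :=
  ∃ σ₀ : ℝ, 0 < σ₀ ∧ ∀ (σlo σhi θlo θhi U : ℝ), 0 < σlo → σhi < σ₀ → 0 < θlo → ∃ β₀ : ℝ, 0 < β₀ ∧ ∀ σ' ∈ Set.Icc σlo σhi, ∀ θ ∈ Set.Icc θlo θhi, ∀ u : EuclideanSpace ℝ (Fin 3), ‖u‖ ≤ U → ∀ ε : ℕ → ℝ, (∀ M, 0 < ε M) → Filter.Tendsto (fun M : ℕ => ((M : ℝ) + 1) * ε M ^ 3) Filter.atTop (nhds (σ' ^ 3)) → ∀ Φ : (M : ℕ) → Literature.Analysis.FluidPDE.HardSphereFlow (Literature.Analysis.FluidPDE.Torus.geometry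 (Fin 3)) (ε M) (M + 1), ∀ (A₀ A₄ : UnitAddTorus (Fin 3) → EuclideanSpace ℝ (Fin 3)) (A : Fin 3 → UnitAddTorus (Fin 3) → EuclideanSpace ℝ (Fin 3)), Literature.Analysis.FunctionSpaces.Torus.IsSmooth A₀ → Literature.Analysis.FunctionSpaces.Torus.IsSmooth A₄ → (∀ k, Literature.Analysis.FunctionSpaces.Torus.IsSmooth (A k)) → (∀ x, ‖A₀ x‖ ≤ β₀) → (∀ x, ‖A₄ x‖ ≤ β₀) → (∀ k x, ‖A k x‖ ≤ β₀) → ∀ δ : ℝ, 0 < δ → ∃ K₀ : ℝ, ∀ K ≥ K₀, ∃ L₀ : ℝ, ∀ L ≥ L₀, ∃ k₀ : ℝ, ∀ k ≥ k₀, Filter.limsup (fun M : ℕ => let τ : ℝ := L * ((M : ℝ) + 1) ^ (-(1 / 3 : ℝ)); let bk : UnitAddTorus (Fin 3) → UnitAddTorus (Fin 3) → ℝ := fun x y => 3 / (Real.pi * (k * ((M : ℝ) + 1) ^ (-(1 / 3 : ℝ))) ^ 3) * max 0 (1 - Literature.Analysis.FluidPDE.Torus.euclidDist x y / (k * ((M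 : ℝ) + 1) ^ (-(1 / 3 : ℝ)))); let kin : (Fin (M + 1) → UnitAddTorus (Fin 3) × EuclideanSpace ℝ (Fin 3)) → ℝ := fun z => ∑ i, if ‖(z i).2‖ ≤ K then ⟪A₀ (z i).1, (z i).2⟫_ℝ + (∑ j, ⟪A j (z i).1, (z i).2⟫_ℝ * (z i).2 j) + ⟪A₄ (z i).1, (z i).2⟫_ℝ * ‖(z i).2‖ ^ 2 / 2 else 0; let coll : (Fin (M + 1) → UnitAddTorus (Fin 3) × EuclideanSpace ℝ (Fin 3)) → (Fin (M + 1) → UnitAddTorus (Fin 3) × EuclideanSpace ℝ (Fin 3)) → ℝ := fun zl zr => ∑ i, (let Δ : EuclideanSpace ℝ (Fin 3) := (zr i).2 - (zl i).2; let ω : EuclideanSpace ℝ (Fin 3) := ‖Δ‖⁻¹ • Δ; if ‖(zl i).2‖ ≤ K ∧ ‖(zr i).2‖ ≤ K then ε M / 2 * ∫ r in (0 : ℝ)..1, ((∑ j, ⟪A j ((zr i).1 + Literature.Analysis.FunctionSpaces.Torus.proj (-(r * ε M) • ω)), ω⟫_ℝ * Δ j) + ⟪A₄ ((zr i).1 +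 Literature.Analysis.FunctionSpaces.Torus.proj (-(r * ε M) • ω)), ω⟫_ℝ * (‖(zr i).2‖ ^ 2 - ‖(zl i).2‖ ^ 2) / 2) else 0); let flux : (Fin (M + 1) → UnitAddTorus (Fin 3) × EuclideanSpace ℝ (Fin 3)) → ℝ := fun z => ((M : ℝ) + 1) * ∫ x, (let ρ : ℝ := ((M : ℝ) + 1)⁻¹ * ∑ i, (if ‖(z i).2‖ ≤ K then bk x (z i).1 else 0); let m : EuclideanSpace ℝ (Fin 3) := ((M : ℝ) + 1)⁻¹ • ∑ i, (if ‖(z i).2‖ ≤ K then bk x (z i).1 • (z i).2 else 0); let e : ℝ := ((M : ℝ) + 1)⁻¹ * ∑ i, (if ‖(z i).2‖ ≤ K then bk x (z i).1 * ‖(z i).2‖ ^ 2 / 2 else 0); let w : EuclideanSpace ℝ (Fin 3) := ρ⁻¹ • m; let p : ℝ := ρ * (2 / 3 * (e / ρ - ‖w‖ ^ 2 / 2)) * Literature.MathematicalPhysics.KineticTheory.hsCompressibility (min ρ 2 * σ' ^ 3); ⟪A₀ x, m⟫_ℝ + (∑ j, (⟪A j x, m⟫_ℝ * w j + p * A j x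 j)) + ⟪A₄ x, w⟫_ℝ * (e + p)); ((((M : ℝ) + 1)⁻¹ : ℝ) : EReal) * ENNReal.log (∫⁻ z, ENNReal.ofReal (Real.exp (τ⁻¹ * ((∫ s in (0 : ℝ)..τ, kin ((Φ M).flow s z)) + (∑ᶠ s ∈ Literature.Analysis.FluidPDE.collisionTimes (Literature.Analysis.FluidPDE.Torus.geometry (Fin 3)) (ε M) (fun s => (Φ M).flow s z) ∩ Set.Ioc 0 τ, coll (Function.leftLim (fun s => (Φ M).flow s z) s) ((Φ M).flow s z)) - ∫ s in (0 : ℝ)..τ, flux ((Φ M).flow s z)))) ∂(Literature.Analysis.FluidPDE.particleLaw (Φ M) (Literature.Analysis.FluidPDE.canonicalDensity (Literature.Analysis.FluidPDE.Torus.geometry (Fin 3)) (ε M) (M + 1) (Literature.MathematicalPhysics.KineticTheory.localGibbsProfile (fun _ => 1) (fun _ => u) (fun _ => θ)))))) Filter.atTop ≤ (δ : EReal)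

/-- item stmt-AtomisticToContinuum-3655 · crux · rank 3 · closed · moot by None · by planner
why it might fail: the deterministic flow could focus energy ≍ N^(2/3) on O(1) particles with non-vanishing probability — invisible to entropy (sub-exponential LD cost of cubic tails) and to domination by Gibbs; no Povzner/maximum principle for the N-body hard-sphere flow is known.
sources: NachtergaeleYau2003, OllaVaradhanYau1993, Spohn1991
[crux] UNIFORM INTEGRABILITY OF THE ENERGY-CURRENT TAILS BEFORE THE FIRST SHOCK (card crux 3's
irreducible tail input; the consumable, corrected form of RelEntropyErgodic's LargeVelocityControl
0781, whose exponential-cubic-moment wording is false already at t = 0). For continuous profiles ∃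
σ₀ ∀ σ ∈ (0,σ₀) ∀ classical hs-Euler solutions (ρ,u,θ) on [0,T) ∀ flow families Φ_N: if the local
Gibbs fields converge at t = 0 to (ρ,ρu,E)(0), then ∀ t < T ∀ ε > 0 ∃ M ∃ N₀ ∀ N ≥ N₀ ∀ s ∈ [0,t]:
E_{λ^N}[(N+1)⁻¹ Σ_i |v_i(s)|³ 1{|v_i(s)| > M}] ≤ ε, v_i(s) the velocities of (Φ_N.flow s z). On
pre-shock horizons it follows from the catalogued open hypothesis
Literature.Barriers.AtomisticToContinuum.HighMomentumCutoff σ (Nachtergaele–Yau II.1 transcribed),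
which is NOT assumed here (the item is weaker: cubic uniform integrability in mean, pre-shock only,
σ₀ profile-dependent). [difficulty: open-problem] -/
@[route_item "route-AtomisticToContinuum-BallwiseGibbsReferences"]
def EnergyCurrentTails : Prop :=
  ∀ (a₀ θ₀ : Literature.MathematicalPhysics.KineticTheory.T3 → ℝ) (u₀ : Literature.MathematicalPhysics.KineticTheory.T3 → Literature.MathematicalPhysics.KineticTheory.V3), Continuous a₀ → Continuous θ₀ → Continuous u₀ → (∀ x, 0 < a₀ x) → (∀ x, 0 < θ₀ x) → ∃ σ₀ : ℝ, 0 < σ₀ ∧ ∀ σ : ℝ, 0 < σ → σ < σ₀ → ∀ (T : ℝ) (ρ θ : ℝ → Literature.MathematicalPhysics.KineticTheory.T3 → ℝ) (u : ℝ → Literature.MathematicalPhysics.KineticTheory.T3 → Literature.MathematicalPhysics.KineticTheory.V3), Literature.MathematicalPhysics.KineticTheory.IsHardSphereEulerSolution σ T ρ u θ → ∀ Φ : (N : ℕ) → Literature.Analysis.FluidPDE.HardSphereFlow (Literature.Analysis.FluidPDE.Torus.geometry (Fin 3)) (Literature.MathematicalPhysics.KineticTheory.hsDiameter σ N) (N +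 1), Literature.MathematicalPhysics.KineticTheory.TendstoHydroFieldsAt (fun N => Literature.MathematicalPhysics.KineticTheory.localGibbsLaw σ a₀ u₀ θ₀ N (Φ N)) Φ ρ u θ 0 → ∀ t ∈ Set.Ico 0 T, ∀ ε : ℝ, 0 < ε → ∃ M : ℝ, ∃ N₀ : ℕ, ∀ N : ℕ, N₀ ≤ N → ∀ s ∈ Set.Icc 0 t, ∫⁻ z, ENNReal.ofReal (((N : ℝ) + 1)⁻¹ * ∑ i : Fin (N + 1), Set.indicator {v : Literature.MathematicalPhysics.KineticTheory.V3 | M < ‖v‖} (fun v => ‖v‖ ^ 3) (((Φ N).flow s z i).2)) ∂(Literature.MathematicalPhysics.KineticTheory.localGibbsLaw σ a₀ u₀ θ₀ N (Φ N)) ≤ ENNReal.ofReal ε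

/-- item stmt-AtomisticToContinuum-6455 · crux · rank 4 · closed · moot by None · by planner
why it might fail: needs collision-RATE control of fast particles under the non-equilibrium law (contact pair densities of f_t around fast spheres); channelled fast spheres or transient dense clusters could carry O(1) throughput at polynomially small probability, which entropy bounds cannot see.
sources: BuragoFerlegerKononenko1998, GST2013, Alexander1975, NachtergaeleYau2003
[crux] VANISHING FAST-COLLISION THROUGHPUT under the true law, pre-shock (the collisional truncation
error of LFG's functional, in the currency of card apriori-tails-and-rattlers): for continuous
profiles ∃ σ₀ ∀ σ < σ₀ ∀ classical hs-Euler solutions on [0,T) ∀ flow families, if the local Gibbs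
fields converge at t = 0 then ∀ t < T ∀ η > 0 ∃ K ∃ N₀ ∀ N ≥ N₀: (N+1)^(-4/3) E[ Σ_i Σ_(collision
times s ≤ t) 1(max(|v_i(s⁻)|,|v_i(s)|) > K) (1 + |v_i(s)+v_i(s⁻)|/2) |v_i(s) − v_i(s⁻)| ] ≤ η
(normalisation: (N+1)^(4/3) = order of the total number of collisions on [0,t]; the summand vanishes
unless i collides at s). [difficulty: L] -/
@[route_item "route-AtomisticToContinuum-BallwiseGibbsReferences"]
def FastCollisionThroughput : Prop :=
  ∀ (a₀ θ₀ : Literature.MathematicalPhysics.KineticTheory.T3 → ℝ) (u₀ : Literature.MathematicalPhysics.KineticTheory.T3 → Literature.MathematicalPhysics.KineticTheory.V3), Continuous a₀ → Continuous θ₀ → Continuous u₀ → (∀ x, 0 < a₀ x) → (∀ x, 0 < θ₀ x) → ∃ σ₀ : ℝ, 0 < σ₀ ∧ ∀ σ : ℝ, 0 < σ → σ < σ₀ → ∀ (T : ℝ) (ρ θ : ℝ → Literature.MathematicalPhysics.KineticTheory.T3 → ℝ) (u : ℝ → Literature.MathematicalPhysics.KineticTheory.T3 → Literature.MathematicalPhysics.KineticTheory.V3),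 Literature.MathematicalPhysics.KineticTheory.IsHardSphereEulerSolution σ T ρ u θ → ∀ Φ : (N : ℕ) → Literature.Analysis.FluidPDE.HardSphereFlow (Literature.Analysis.FluidPDE.Torus.geometry (Fin 3)) (Literature.MathematicalPhysics.KineticTheory.hsDiameter σ N) (N + 1), Literature.MathematicalPhysics.KineticTheory.TendstoHydroFieldsAt (fun N => Literature.MathematicalPhysics.KineticTheory.localGibbsLaw σ a₀ u₀ θ₀ N (Φ N)) Φ ρ u θ 0 → ∀ t ∈ Set.Ico 0 T, ∀ η : ℝ, 0 < η → ∃ K : ℝ, ∃ N₀ : ℕ, ∀ N : ℕ, N₀ ≤ N → ∫⁻ z, ENNReal.ofReal ((((N : ℝ) + 1) ^ (-(4 / 3 : ℝ))) * ∑ i : Fin (N + 1), ∑ᶠ s ∈ Literature.Analysis.FluidPDE.collisionTimes (Literature.Analysis.FluidPDE.Torus.geometry (Fin 3)) (Literature.MathematicalPhysics.KineticTheory.hsDiameter σ N) (fun s => (Φ N).flow s z) ∩ Set.Ioc 0 t, (if K < max ‖(Function.leftLim (fun s => (Φ N).flow s z) s i).2‖ ‖((Φ N).flow s z i).2‖ then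 (1 + ‖((Φ N).flow s z i).2 + (Function.leftLim (fun s => (Φ N).flow s z) s i).2‖ / 2) * ‖((Φ N).flow s z i).2 - (Function.leftLim (fun s => (Φ N).flow s z) s i).2‖ else 0)) ∂(Literature.MathematicalPhysics.KineticTheory.localGibbsLaw σ a₀ u₀ θ₀ N (Φ N)) ≤ ENNReal.ofReal η

-- earlier BallwiseSufficiency (stmt-AtomisticToContinuum-6456, replaced 2026-08-15T12:39:58Z -> stmt-AtomisticToContinuum-8346): moot by None — LocalFluxGibbsianity ∧ EnergyCurrentTails ∧ FastCollisionThroughput → RelEntropyVanishing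
/-- item stmt-AtomisticToContinuum-8346 · crux · rank 5 · closed · moot by None · by planner
why it might fail: window locality under f_t with only cubic-UI tails, the o(N_B) hard-core boundary/ensemble corrections for ball marginals, the parameter/time grids and the inverse equation of state for a_t must all close at o(N); any of these may demand more than items 3–4 supply.
sources: Yau1991, OllaVaradhanYau1993, KipnisLandim1999, Spohn1991
[crux] THE BALL-WISE SUFFICIENCY THEOREM (card local-flux-gibbsianity-ballwise crux 2 made an
implication): LocalFluxGibbsianity → EnergyCurrentTails → FastCollisionThroughput →
RelEntropyVanishing. Proof plan: Yau's Gronwall for H(f_t | ψ_t) on the torus with ψ_t the local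
Gibbs law driven by the classical solution; quadratic remainder by static LD; for the one-block term
tile [0,t] by micro windows L(N+1)^(-1/3), cover 𝕋³ by balls of radius r with a partition of unity
χ_B, test the collision-resolved recentred current against χ_B∇λ_t (non-gradient, sup-norm ≤ β₀
after choosing the entropy-inequality parameter a = β₀/sup|∇λ_t|), apply the entropy inequality
ball-wise to the B⁺-marginal of f_t against the marginal of the homogeneous invariant Gibbs law of
an (M+1)-sphere torus system with M+1 ≈ ρ_B(N+1) and parameters (σρ_B^(1/3), u_B, θ_B) on an r-grid;
entropy mismatch ≤ N_B(h_B + Cr² + Cr√h_B) + o(N_B) (second order in r; cross term via the static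
entropy inequality), Σ_B N_B h_B ≤ C_ov H + o(N) (superadditivity for near-product hard-core
references), microscopic locality of X_B over the window from deterministic light cones for
particles slower than K plus items 3–4, pressures -/
@[route_item "route-AtomisticToContinuum-BallwiseGibbsReferences"]
def BallwiseSufficiency : Prop :=
  LocalFluxGibbsianity → EnergyCurrentTails → FastCollisionThroughput → RelEntropyVanishing

/-- item stmt-AtomisticToContinuum-0769 · support · rank 9 · open · by planner
sources: KipnisLandim1999, Yau1991
[assembly] X_RE → HydrodynamicLimit: entropy inequality μ(A) ≤ (log 2 + H(μ|λ))/log(1 + 1/λ(A))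
(from Donsker–Varadhan / Mathlib klDiv API) with λ(A) ≤ C e^{-(N+1)/C} and H = o(N) gives μ(A) → 0;
μ = lawAt (Φ N) P t = P.map (flow t) turns μ{z | δ < |field z − ·|} into P{z | δ < |field (flow t z)
− ·|} (measurable_flow); the reference concentration is stated for z itself and TendstoHydroFieldsAt
at time 0 of the reference law is not needed. Zero-mass case impossible by the IsProbabilityMeasure
clauses; take σ₀ from X_RE. -/
@[route_item "route-AtomisticToContinuum-BallwiseGibbsReferences"]
def EntropyToFields : Prop :=
  RelEntropyVanishing → Literature.MathematicalPhysics.KineticTheory.HydrodynamicLimit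

-- earlier Assembly (stmt-AtomisticToContinuum-8237, replaced 2026-08-15T12:41:01Z -> stmt-AtomisticToContinuum-8353): retired by None — EnergyCurrentTails → FastCollisionThroughput → LocalFluxGibbsianity → BallwiseSufficiency → EntropyToFields → Literature.MathematicalPhysics.KineticTheory.HydrodynamicLimit
/-- item stmt-AtomisticToContinuum-8353 · assembly · rank 1 · closed · moot by None · by planner
sources: Yau1991, OllaVaradhanYau1993
[assembly] LocalFluxGibbsianity → EnergyCurrentTails → FastCollisionThroughput → BallwiseSufficiency
→ EntropyToFields → HydrodynamicLimit (pure logic, sorry-free in the planner's Sketch.lean: fun h1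
h2 h3 h4 h5 => h5 (h4 h1 h2 h3)); the content sits in BallwiseSufficiency (ball-wise Gronwall) and
EntropyToFields (entropy inequality, stmt-0769) -/
@[route_item "route-AtomisticToContinuum-BallwiseGibbsReferences"]
def Assembly : Prop :=
  LocalFluxGibbsianity → EnergyCurrentTails → FastCollisionThroughput → BallwiseSufficiency → EntropyToFields → Literature.MathematicalPhysics.KineticTheory.HydrodynamicLimit

end Summit.AtomisticToContinuum.HydrodynamicLimit.Theses.BallwiseGibbsReferences
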